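import Summits.Ventures.WeilGRH.UniformConductorFloorJointDataLog10
import HarnessLib

/-!
# GRH arm (rh-explicit, venture WeilGRH): kernel check of the ODD joint cell certificate `certOddLog10` at `(log 10)/2` — part B

Cell `rh-explicit`, WEIL TRACK — GRH ARM (weil-grh-1, gen9).  The cells `[184, 368)` of `certOddLog10`
(`UniformConductorFloorJointDataLog10.lean`) by `decide +kernel` (integer arithmetic only; one range per file).  Glued in `UniformConductorFloorJointFloorsLog10.lean` by
`JointCert.cellsLoop_spec`.  No definitions; no named facts; standard axioms. [folklore]
-/

namespace Summit.Ventures.WeilGRH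

namespace UniformFloor

set_option maxHeartbeats 0 in
set_option maxRecDepth 100000 in
/-- Cells `[184, 368)` of `certOddLog10`. [folklore] -/
theorem certOddLog10_cellsB : certOddLog10.cellsRange 184 184 = true := by
  decide +kernel

end UniformFloor

end Summit.Ventures.WeilGRH
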